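import Mathlib
import Literature.NumberTheory.LFunctions.Zhang2022.Section15ResidueLimits
import Literature.NumberTheory.LFunctions.Zhang2022.Section16ResidueLimits
import HarnessLib

/-!
# Zhang (2022), §16 (16.10): the integrand of §16.u023 as `Φ·K`, its singular points in Landau's
# rectangle, and the punctured limits at them (residues `ℛ₂ⱼ d^{βⱼ} ℳ₂(d,l;1−βⱼ)`)

Topic `Literature/NumberTheory/LFunctions/Zhang2022` (Landau–Siegel audit tree; verdict-neutral).
Y. Zhang, *Discrete mean estimates and the Landau–Siegel zero*, arXiv:2211.02515v1 (2022)
[Zhang2022LandauSiegel] — **an unrefereed manuscript under adjudication**; nothing here asserts its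
Theorems 1–2. DAG nodes `Z22:(16.10)`, `Z22:(16.11)`, `Z22:§16.u023` [Z22 p.92, tex L4545–L4556]:

> Assume `dl < P₂²`, and `(dl,D) = 1`. Note that `P₄/d > T`. In a way similar to the proof of (15.15),
> we deduce that `𝒟₂(d,l) = λ₂(d) Σ_{j=1,2} ℛ₂ⱼ d^{βⱼ} ℳ₂(d,l;1−βⱼ) + O(ε₁)` (16.10), where `ℛ₂ⱼ` is
> the residue of `ζ(1+s+β₁)/(ζ(1+s)L(1+s,χ)) · P₄^{s+β₂}ω₁(s+β₂)/(s+β₂)` (16.11) at `s = −βⱼ`.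

This file is the LOCAL analysis of the integrand of the display §16.u023
(`Typed.Section16A.integrand16_u023 c′ χ d l`, the function integrated on `Re s = 1` there): it is
`Φ(s)·K(s)` with the Gaussian Perron kernel `K(s) = P₄^{s+β₂}ω₁(s+β₂)/(s+β₂)` of the tree's contour
engine `GaussKernelContour` and `Φ(s) = ζ(1+s+β₁)ℳ₂(d,l;1+s)/(ζ(1+s)L(1+s,χ))·d^{−s}`
(`integrand16_u023_eq_mul_kernel`); equivalently `(16.11)·ℳ₂(d,l;1+s)·d^{−s}`
(`integrand16_u023_eq_F1611_mul`). In a rectangle `[−η, 1] × [−H, H]` (`η ≍ 1/𝓛`) it has at most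
simple poles, and the punctured limits `lim_{z→p} (z−p)·(integrand)(z)` exist at

* `p = −β₁` (pole of `ζ(1+s+β₁)`): value `ℛ₂₁·d^{β₁}·ℳ₂(d,l;1−β₁)` (`tendsto_integrand_neg_beta1`);
* `p = −β₂` (pole of the kernel): value `ℛ₂₂·d^{β₂}·ℳ₂(d,l;1−β₂)` (`tendsto_integrand_neg_beta2`);
* `p = 0`: value `0` — NOT a pole (`1/ζ(1+s)` vanishes there), but a point where the LITERAL typed
  function is not holomorphic, Lean's `riemannZeta 1` being a finite junk value
  (`tendsto_integrand_zero`);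
* `p = ρ̃ − 1`, `ρ̃` the exceptional real zero of `L(s,χ)` (Lemma 5.5): value
  `L′(ρ̃,χ)⁻¹·ζ(ρ̃+β₁)ℳ₂(d,l;ρ̃)ζ(ρ̃)⁻¹·K(ρ̃−1)d^{1−ρ̃}` (`tendsto_integrand_excZero`) — "the residue
  at this point can be regarded as an acceptable error" (p.85, tex L4224);

here `ℛ₂ⱼ = Typed.Section16A.calR2 c′ χ j` is the typed residue (a `limUnder`, identified in the tree
by `Skeleton.tendsto_residue1611_one/two`). Holomorphy of the integrand off these points
(`differentiableAt_integrand`) and continuity of `Φ` along vertical lines (`continuousAt_Phi`) are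
recorded for the contour engine. All hypotheses (non-vanishing of `ζ`, `L` at the relevant points,
holomorphy of `ℳ₂` — node §16.u021an) are explicit; no parameter sizes are used here.

## References

* Y. Zhang, arXiv:2211.02515v1 (2022), §16 (16.10)–(16.11), §16.u023 p.92; §15 (15.15) p.85.
  [cite: Zhang2022LandauSiegel, §16 (16.10)–(16.11) p.92]
* J. B. Conway, *Functions of One Complex Variable I*, GTM 11, Ch. V §1–§2. [cite: Conway1978, V.2.2]
-/

noncomputable section

open Complex Real Filter Topology Set
open Literature.NumberTheory.LFunctions.Zhang2022
open Literature.NumberTheory.LFunctions.Zhang2022.Skeleton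
open Literature.NumberTheory.LFunctions.Zhang2022.Typed.Section16A

namespace Literature.NumberTheory.LFunctions.Zhang2022.Eq1610

variable (c' : ℝ) {D : ℕ} [NeZero D] (χ : DirichletCharacter ℂ D) (d l : ℕ)

/-! ## The two factorizations of the integrand of §16.u023 -/

/-- **The integrand of §16.u023 is `Φ·K`** with the Gaussian Perron kernel
`K(s) = P₄^{s+β₂}ω₁(s+β₂)/(s+β₂)` and `Φ(s) = ζ(1+s+β₁)ℳ₂(d,l;1+s)/(ζ(1+s)L(1+s,χ))·(d^s)⁻¹`.
[cite: Zhang2022LandauSiegel, §16 p.92 (u023)] -/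
theorem integrand16_u023_eq_mul_kernel (s : ℂ) :
    integrand16_u023 c' χ d l s =
      (riemannZeta (1 + s + beta1 c' D) * calM2 c' χ d l (1 + s) /
          (riemannZeta (1 + s) * χ.LFunction (1 + s)) * ((d : ℂ) ^ s)⁻¹) *
        (((P4 D : ℝ) : ℂ) ^ (s + beta2 c' D) * GaussWeight.omega1 (ell D ^ 30) (s + beta2 c' D) /
          (s + beta2 c' D)) := by
  unfold integrand16_u023
  ring

/-- **The integrand of §16.u023 is (16.11) times `ℳ₂(d,l;1+s)·d^{−s}`**.
[cite: Zhang2022LandauSiegel, §16 (16.11) p.92] -/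
theorem integrand16_u023_eq_F1611_mul (s : ℂ) :
    integrand16_u023 c' χ d l s = F1611 c' χ s * calM2 c' χ d l (1 + s) * ((d : ℂ) ^ s)⁻¹ := by
  unfold integrand16_u023 F1611
  ring

/-! ## Continuity and holomorphy of the regular factors -/

section Regular

variable {c' χ d l}

/-- `z ↦ (d^z)⁻¹` is continuous and `d^z ≠ 0` (`d ≥ 1`). [cite: Zhang2022LandauSiegel, §16 (16.10) p.92] -/
theorem continuousAt_cpow_inv (hd : d ≠ 0) (z : ℂ) :
    ContinuousAt (fun s : ℂ => ((d : ℂ) ^ s)⁻¹) z ∧ (d : ℂ) ^ z ≠ 0 := by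
  have hd' : (d : ℂ) ≠ 0 := Nat.cast_ne_zero.mpr hd
  have hne : (d : ℂ) ^ z ≠ 0 := by
    rw [Ne, Complex.cpow_eq_zero_iff]; exact fun h => hd' h.1
  exact ⟨(continuousAt_const_cpow hd').inv₀ hne, hne⟩

/-- `z ↦ (d^z)⁻¹` is entire (`d ≥ 1`). [cite: Zhang2022LandauSiegel, §16 (16.10) p.92] -/
theorem differentiableAt_cpow_inv (hd : d ≠ 0) (z : ℂ) :
    DifferentiableAt ℂ (fun s : ℂ => ((d : ℂ) ^ s)⁻¹) z := by
  have hd' : (d : ℂ) ≠ 0 := Nat.cast_ne_zero.mpr hd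
  have hne : (d : ℂ) ^ z ≠ 0 := by
    rw [Ne, Complex.cpow_eq_zero_iff]; exact fun h => hd' h.1
  exact (differentiableAt_id.const_cpow (Or.inl hd')).inv hne

omit [NeZero D] in
/-- The kernel `K(s) = P₄^{s+β₂}ω₁(s+β₂)/(s+β₂)` is continuous at `z` with `z + β₂ ≠ 0` (`P₄ > 0`).
[cite: Zhang2022LandauSiegel, §4 (4.1) p.17] -/
theorem continuousAt_kernel (hP : 0 < P4 D) {z : ℂ} (hz : z + beta2 c' D ≠ 0) :
    ContinuousAt (fun s : ℂ => ((P4 D : ℝ) : ℂ) ^ (s + beta2 c' D) *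
      GaussWeight.omega1 (ell D ^ 30) (s + beta2 c' D) / (s + beta2 c' D)) z :=
  (ResidueValues.continuousAt_P4pow_omega1 (D := D) hP (beta2 c' D) z).div (by fun_prop) hz

/-- **Continuity of `Φ`** at a point `z` with `z + β₁ ≠ 0`, `z ≠ 0`, `ζ(1+z) ≠ 0`, `L(1+z,χ) ≠ 0`,
`ℳ₂(d,l;·)` continuous at `1 + z` (`χ ≠ 1`, `d ≥ 1`). [cite: Zhang2022LandauSiegel, §16 p.92 (u023)] -/
theorem continuousAt_Phi (hχ : χ ≠ 1) (hd : d ≠ 0) {z : ℂ} (hz1 : z + beta1 c' D ≠ 0) (hz0 : z ≠ 0)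
    (hζ : riemannZeta (1 + z) ≠ 0) (hL : χ.LFunction (1 + z) ≠ 0)
    (hM : ContinuousAt (fun s : ℂ => calM2 c' χ d l (1 + s)) z) :
    ContinuousAt (fun s : ℂ => riemannZeta (1 + s + beta1 c' D) * calM2 c' χ d l (1 + s) /
      (riemannZeta (1 + s) * χ.LFunction (1 + s)) * ((d : ℂ) ^ s)⁻¹) z := by
  have cζ1 := ResidueValues.continuousAt_zeta_shift (beta1 c' D) z hz1
  have cζ := ResidueValues.continuousAt_zeta_one_add z hz0
  have cL := ResidueValues.continuousAt_LFunction_one_add χ hχ z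
  have cd := (continuousAt_cpow_inv (d := d) hd z).1
  exact ((cζ1.mul hM).div (cζ.mul cL) (mul_ne_zero hζ hL)).mul cd

/-- **Holomorphy of the integrand** at a point `z` with `z + β₁ ≠ 0`, `z ≠ 0`, `z + β₂ ≠ 0`,
`ζ(1+z) ≠ 0`, `L(1+z,χ) ≠ 0`, and `ℳ₂(d,l;1+·)` differentiable at `z` (`χ ≠ 1`, `d ≥ 1`, `P₄ > 0`).
[cite: Zhang2022LandauSiegel, §16 p.92 (u023)] -/
theorem differentiableAt_integrand (hχ : χ ≠ 1) (hd : d ≠ 0) (hP : 0 < P4 D) {z : ℂ}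
    (hz1 : z + beta1 c' D ≠ 0) (hz0 : z ≠ 0) (hz2 : z + beta2 c' D ≠ 0)
    (hζ : riemannZeta (1 + z) ≠ 0) (hL : χ.LFunction (1 + z) ≠ 0)
    (hM : DifferentiableAt ℂ (fun s : ℂ => calM2 c' χ d l (1 + s)) z) :
    DifferentiableAt ℂ (integrand16_u023 c' χ d l) z := by
  have h1 : (1 : ℂ) + z + beta1 c' D ≠ 1 := by
    intro h; apply hz1; linear_combination h
  have h0 : (1 : ℂ) + z ≠ 1 := by
    intro h; apply hz0; linear_combination h
  have dζ1 : DifferentiableAt ℂ (fun s : ℂ => riemannZeta (1 + s + beta1 c' D)) z :=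
    (differentiableAt_riemannZeta h1).comp z (by fun_prop)
  have dζ : DifferentiableAt ℂ (fun s : ℂ => riemannZeta (1 + s)) z :=
    (differentiableAt_riemannZeta h0).comp z (by fun_prop)
  have dL : DifferentiableAt ℂ (fun s : ℂ => χ.LFunction (1 + s)) z :=
    ((DirichletCharacter.differentiable_LFunction hχ) _).comp z (by fun_prop)
  have dd := differentiableAt_cpow_inv (d := d) hd z
  have hP' : ((P4 D : ℝ) : ℂ) ≠ 0 := Complex.ofReal_ne_zero.mpr hP.ne'
  have dP : DifferentiableAt ℂ (fun s : ℂ => ((P4 D : ℝ) : ℂ) ^ (s + beta2 c' D)) z :=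
    (differentiableAt_id.add_const _).const_cpow (Or.inl hP')
  have dω : DifferentiableAt ℂ (fun s : ℂ => GaussWeight.omega1 (ell D ^ 30) (s + beta2 c' D)) z := by
    unfold GaussWeight.omega1; fun_prop
  have dden : DifferentiableAt ℂ (fun s : ℂ => s + beta2 c' D) z := by fun_prop
  have dd' : DifferentiableAt ℂ (fun s : ℂ => (d : ℂ) ^ s) z :=
    differentiableAt_id.const_cpow (Or.inl (Nat.cast_ne_zero.mpr hd))
  have hdz : (d : ℂ) ^ z ≠ 0 := (continuousAt_cpow_inv (d := d) hd z).2
  have h : integrand16_u023 c' χ d l = fun s => riemannZeta (1 + s + beta1 c' D) *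
      calM2 c' χ d l (1 + s) / (riemannZeta (1 + s) * χ.LFunction (1 + s)) *
      (((P4 D : ℝ) : ℂ) ^ (s + beta2 c' D) / (d : ℂ) ^ s) *
      (GaussWeight.omega1 (ell D ^ 30) (s + beta2 c' D) / (s + beta2 c' D)) := by
    funext s; rfl
  rw [h]
  exact ((((dζ1.mul hM).div (dζ.mul dL) (mul_ne_zero hζ hL)).mul (dP.div dd' hdz)).mul
    (dω.div dden hz2))

end Regular

/-! ## The punctured limits at `−β₁` and `−β₂`: the residues `ℛ₂ⱼ d^{βⱼ} ℳ₂(d,l;1−βⱼ)` -/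

section Residues

variable {c' χ d l}

/-- **`(s+β₁)·(16.11)(s) → ℛ₂₁`** as `s → −β₁` (`s ≠ −β₁`): the typed residue
`Typed.Section16A.calR2 c′ χ 1` IS the limit, by the existence of the limit
(`Skeleton.tendsto_residue1611_one`) and `tendsto_nhds_limUnder`. Hypotheses: `χ ≠ 1`, `P₄ > 0`,
`β₁ ≠ 0`, `β₁ ≠ β₂`, `ζ(1−β₁) ≠ 0`, `L(1−β₁,χ) ≠ 0`. [cite: Zhang2022LandauSiegel, §16 (16.11) p.92] -/
theorem tendsto_F1611_calR2_one (hχ : χ ≠ 1) (hP : 0 < P4 D) (h1 : beta1 c' D ≠ 0)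
    (h12 : beta1 c' D ≠ beta2 c' D) (hζ : riemannZeta (1 - beta1 c' D) ≠ 0)
    (hL : χ.LFunction (1 - beta1 c' D) ≠ 0) :
    Tendsto (fun s => (s + beta1 c' D) * F1611 c' χ s) (𝓝[≠] (-beta1 c' D))
      (𝓝 (calR2 c' χ 1)) := by
  have hex : ∃ r, Tendsto (fun s => (s + beta1 c' D) * F1611 c' χ s) (𝓝[≠] (-beta1 c' D)) (𝓝 r) :=
    ⟨_, Skeleton.tendsto_residue1611_one χ (Λ := ell D ^ 30) hχ hP h1 h12 hζ hL⟩
  have h := tendsto_nhds_limUnder hex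
  unfold calR2
  rw [ResidueValues.betaJ_one]
  exact h

/-- **`(s+β₂)·(16.11)(s) → ℛ₂₂`** as `s → −β₂` (`s ≠ −β₂`), likewise
(`Skeleton.tendsto_residue1611_two`). Hypotheses: `χ ≠ 1`, `P₄ > 0`, `β₂ ≠ 0`, `β₁ ≠ β₂`,
`ζ(1−β₂) ≠ 0`, `L(1−β₂,χ) ≠ 0`. [cite: Zhang2022LandauSiegel, §16 (16.11) p.92] -/
theorem tendsto_F1611_calR2_two (hχ : χ ≠ 1) (hP : 0 < P4 D) (h2 : beta2 c' D ≠ 0)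
    (h12 : beta1 c' D ≠ beta2 c' D) (hζ : riemannZeta (1 - beta2 c' D) ≠ 0)
    (hL : χ.LFunction (1 - beta2 c' D) ≠ 0) :
    Tendsto (fun s => (s + beta2 c' D) * F1611 c' χ s) (𝓝[≠] (-beta2 c' D))
      (𝓝 (calR2 c' χ 2)) := by
  have hex : ∃ r, Tendsto (fun s => (s + beta2 c' D) * F1611 c' χ s) (𝓝[≠] (-beta2 c' D)) (𝓝 r) :=
    ⟨_, Skeleton.tendsto_residue1611_two χ (Λ := ell D ^ 30) hχ hP h2 h12 hζ hL⟩
  have h := tendsto_nhds_limUnder hex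
  unfold calR2
  rw [ResidueValues.betaJ_two]
  exact h

omit [NeZero D] in
/-- The regular cofactor `ℳ₂(d,l;1+z)·(d^z)⁻¹` is continuous at `p`, hence tends to its value along
the punctured neighbourhood. [cite: Zhang2022LandauSiegel, §16 (16.10) p.92] -/
theorem tendsto_cofactor (hd : d ≠ 0) {p : ℂ}
    (hM : ContinuousAt (fun s : ℂ => calM2 c' χ d l (1 + s)) p) :
    Tendsto (fun z => calM2 c' χ d l (1 + z) * ((d : ℂ) ^ z)⁻¹) (𝓝[≠] p)
      (𝓝 (calM2 c' χ d l (1 + p) * ((d : ℂ) ^ p)⁻¹)) :=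
  ((hM.mul (continuousAt_cpow_inv (d := d) hd p).1).tendsto).mono_left nhdsWithin_le_nhds

/-- **The punctured limit at `s = −β₁`**:
`(z + β₁)·integrand(z) → ℛ₂₁ · d^{β₁} · ℳ₂(d,l;1−β₁)`. [cite: Zhang2022LandauSiegel, §16 (16.10) p.92] -/
theorem tendsto_integrand_neg_beta1 (hχ : χ ≠ 1) (hP : 0 < P4 D) (hd : d ≠ 0) (h1 : beta1 c' D ≠ 0)
    (h12 : beta1 c' D ≠ beta2 c' D) (hζ : riemannZeta (1 - beta1 c' D) ≠ 0)
    (hL : χ.LFunction (1 - beta1 c' D) ≠ 0)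
    (hM : ContinuousAt (fun s : ℂ => calM2 c' χ d l (1 + s)) (-beta1 c' D)) :
    Tendsto (fun z => (z - -beta1 c' D) * integrand16_u023 c' χ d l z) (𝓝[≠] (-beta1 c' D))
      (𝓝 (calR2 c' χ 1 * (d : ℂ) ^ beta1 c' D * calM2 c' χ d l (1 - beta1 c' D))) := by
  have hprod := (tendsto_F1611_calR2_one hχ hP h1 h12 hζ hL).mul (tendsto_cofactor (l := l) hd hM)
  have hval : calR2 c' χ 1 * (calM2 c' χ d l (1 + -beta1 c' D) * ((d : ℂ) ^ (-beta1 c' D))⁻¹) =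
      calR2 c' χ 1 * (d : ℂ) ^ beta1 c' D * calM2 c' χ d l (1 - beta1 c' D) := by
    rw [Complex.cpow_neg, inv_inv, ← sub_eq_add_neg]; ring
  rw [← hval]
  refine hprod.congr fun z => ?_
  rw [integrand16_u023_eq_F1611_mul, sub_neg_eq_add]; ring

/-- **The punctured limit at `s = −β₂`**:
`(z + β₂)·integrand(z) → ℛ₂₂ · d^{β₂} · ℳ₂(d,l;1−β₂)`. [cite: Zhang2022LandauSiegel, §16 (16.10) p.92] -/
theorem tendsto_integrand_neg_beta2 (hχ : χ ≠ 1) (hP : 0 < P4 D) (hd : d ≠ 0) (h2 : beta2 c' D ≠ 0)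
    (h12 : beta1 c' D ≠ beta2 c' D) (hζ : riemannZeta (1 - beta2 c' D) ≠ 0)
    (hL : χ.LFunction (1 - beta2 c' D) ≠ 0)
    (hM : ContinuousAt (fun s : ℂ => calM2 c' χ d l (1 + s)) (-beta2 c' D)) :
    Tendsto (fun z => (z - -beta2 c' D) * integrand16_u023 c' χ d l z) (𝓝[≠] (-beta2 c' D))
      (𝓝 (calR2 c' χ 2 * (d : ℂ) ^ beta2 c' D * calM2 c' χ d l (1 - beta2 c' D))) := by
  have hprod := (tendsto_F1611_calR2_two hχ hP h2 h12 hζ hL).mul (tendsto_cofactor (l := l) hd hM)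
  have hval : calR2 c' χ 2 * (calM2 c' χ d l (1 + -beta2 c' D) * ((d : ℂ) ^ (-beta2 c' D))⁻¹) =
      calR2 c' χ 2 * (d : ℂ) ^ beta2 c' D * calM2 c' χ d l (1 - beta2 c' D) := by
    rw [Complex.cpow_neg, inv_inv, ← sub_eq_add_neg]; ring
  rw [← hval]
  refine hprod.congr fun z => ?_
  rw [integrand16_u023_eq_F1611_mul, sub_neg_eq_add]; ring

end Residues

/-! ## The removable point `s = 0` and the exceptional-zero pole `s = ρ̃ − 1` -/

section OtherPoints

variable {c' χ d l}

/-- `z/ζ(1+z) → 0` as `z → 0`, `z ≠ 0` (`ζ(1+z) = z⁻¹ζ₁(1+z)`, `ζ₁(1) = 1`, Mathlib `riemannZeta₁`).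
[cite: Zhang2022LandauSiegel, §16 (16.10) p.92] -/
theorem tendsto_mul_inv_zeta_one_add :
    Tendsto (fun z : ℂ => z * (riemannZeta (1 + z))⁻¹) (𝓝[≠] 0) (𝓝 0) := by
  -- the continuous function `z² / ζ₁(1+z)` agrees with `z/ζ(1+z)` off `0` and vanishes at `0`
  have hc : ContinuousAt (fun z : ℂ => z ^ 2 * (riemannZeta₁ (1 + z))⁻¹) 0 := by
    have h1 : ContinuousAt (fun z : ℂ => riemannZeta₁ (1 + z)) 0 :=
      (differentiable_riemannZeta₁.continuous.comp (by fun_prop : Continuous fun z : ℂ => 1 + z)).continuousAt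
    have hne : riemannZeta₁ (1 + 0) ≠ 0 := by rw [add_zero, riemannZeta₁_one]; exact one_ne_zero
    exact (continuousAt_id.pow 2).mul (h1.inv₀ hne)
  have hlim := hc.tendsto
  simp only [ne_eq, OfNat.ofNat_ne_zero, not_false_eq_true, zero_pow, zero_mul] at hlim
  refine (hlim.mono_left nhdsWithin_le_nhds).congr' ?_
  filter_upwards [self_mem_nhdsWithin] with z hz
  have hz : z ≠ 0 := hz
  have h1 : (1 : ℂ) + z ≠ 1 := by
    intro h; apply hz; linear_combination h
  rw [riemannZeta_eq_inv_sub_mul h1, add_sub_cancel_left, mul_inv, inv_inv]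
  ring

/-- **The punctured limit at `s = 0` is `0`**: the literal typed integrand (with Lean's finite
`riemannZeta 1`) is `z/ζ(1+z) → 0` times a factor continuous at `0` (`L(1,χ) ≠ 0`, `β₁, β₂ ≠ 0`,
`ℳ₂` continuous at `1`). So `s = 0` contributes no residue; it only has to be excised from the domain
of holomorphy. [cite: Zhang2022LandauSiegel, §16 (16.10)–(16.11) p.92] -/
theorem tendsto_integrand_zero (hχ : χ ≠ 1) (hP : 0 < P4 D) (hd : d ≠ 0) (h1 : beta1 c' D ≠ 0)
    (h2 : beta2 c' D ≠ 0) (hM : ContinuousAt (fun s : ℂ => calM2 c' χ d l (1 + s)) 0) :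
    Tendsto (fun z => (z - 0) * integrand16_u023 c' χ d l z) (𝓝[≠] 0) (𝓝 0) := by
  -- the regular factor at `0`
  set R : ℂ → ℂ := fun z => riemannZeta (1 + z + beta1 c' D) * calM2 c' χ d l (1 + z) *
    (χ.LFunction (1 + z))⁻¹ * ((d : ℂ) ^ z)⁻¹ *
    (((P4 D : ℝ) : ℂ) ^ (z + beta2 c' D) * GaussWeight.omega1 (ell D ^ 30) (z + beta2 c' D) /
      (z + beta2 c' D)) with hR
  have hRc : ContinuousAt R 0 := by
    have hz1 : (0 : ℂ) + beta1 c' D ≠ 0 := by rwa [zero_add]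
    have hz2 : (0 : ℂ) + beta2 c' D ≠ 0 := by rwa [zero_add]
    have cζ1 := ResidueValues.continuousAt_zeta_shift (beta1 c' D) 0 hz1
    have cL := ResidueValues.continuousAt_LFunction_one_add χ hχ (0 : ℂ)
    have hL1 : χ.LFunction (1 + 0) ≠ 0 := by
      rw [add_zero]; exact DirichletCharacter.LFunction_apply_one_ne_zero hχ
    have cd := (continuousAt_cpow_inv (d := d) hd (0 : ℂ)).1
    have cK := continuousAt_kernel (c' := c') hP hz2
    exact (((cζ1.mul hM).mul (cL.inv₀ hL1)).mul cd).mul cK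
  have hprod := tendsto_mul_inv_zeta_one_add.mul (hRc.tendsto.mono_left nhdsWithin_le_nhds)
  rw [zero_mul] at hprod
  refine hprod.congr fun z => ?_
  rw [sub_zero, hR]
  unfold integrand16_u023
  simp only [div_eq_mul_inv, mul_inv]
  ring

/-- `(z − u₁)/L(1+z,χ) → L′(ρ,χ)⁻¹` as `z → u₁ = ρ − 1`, for a zero `ρ` of `L(·,χ)` with
`L′(ρ,χ) ≠ 0` (`χ ≠ 1`): the reciprocal of the difference quotient. [cite: Zhang2022LandauSiegel, §16 (16.10) p.92] -/
theorem tendsto_sub_mul_inv_LFunction (hχ : χ ≠ 1) {ρ : ℂ} (hLρ : χ.LFunction ρ = 0)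
    (hL'ρ : deriv χ.LFunction ρ ≠ 0) :
    Tendsto (fun z : ℂ => (z - (ρ - 1)) * (χ.LFunction (1 + z))⁻¹) (𝓝[≠] (ρ - 1))
      (𝓝 (deriv χ.LFunction ρ)⁻¹) := by
  -- the derivative of `w ↦ L(1+w,χ)` at `u₁ = ρ − 1` is `L′(ρ,χ)`
  have hLd := DirichletCharacter.differentiable_LFunction hχ
  have hg : HasDerivAt (fun w : ℂ => 1 + w) 1 (ρ - 1) := (hasDerivAt_id _).const_add 1
  have hcomp : HasDerivAt (fun w : ℂ => χ.LFunction (1 + w)) (deriv χ.LFunction ρ) (ρ - 1) := by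
    have h := ((hLd (1 + (ρ - 1))).hasDerivAt).comp (ρ - 1) hg
    rw [show (1 : ℂ) + (ρ - 1) = ρ by ring, mul_one] at h
    exact h
  have hslope := hcomp.tendsto_slope
  have hinv := hslope.inv₀ hL'ρ
  refine hinv.congr' ?_
  filter_upwards [self_mem_nhdsWithin] with z hz
  have hz : z ≠ ρ - 1 := hz
  have hval : χ.LFunction (1 + (ρ - 1)) = 0 := by rw [show (1 : ℂ) + (ρ - 1) = ρ by ring, hLρ]
  rw [slope_def_field, hval, sub_zero, inv_div, div_eq_mul_inv]

/-- **The punctured limit at the exceptional-zero pole `s = u₁ = ρ − 1`** (`ρ` a zero of `L(·,χ)`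
with `L′(ρ,χ) ≠ 0`, `ρ ≠ 1`, `ζ(ρ) ≠ 0`, `u₁ + β₁ ≠ 0`, `u₁ + β₂ ≠ 0`, `ℳ₂` continuous at `ρ`):
`(z − u₁)·integrand(z) → L′(ρ,χ)⁻¹ · ζ(ρ+β₁)ℳ₂(d,l;ρ)ζ(ρ)⁻¹(d^{u₁})⁻¹ · K(u₁)`.
[cite: Zhang2022LandauSiegel, §15 (15.15)–(15.16) p.85] -/
theorem tendsto_integrand_excZero (hχ : χ ≠ 1) (hP : 0 < P4 D) (hd : d ≠ 0) {ρ : ℂ}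
    (hLρ : χ.LFunction ρ = 0) (hL'ρ : deriv χ.LFunction ρ ≠ 0) (hρ1 : ρ ≠ 1)
    (hζρ : riemannZeta ρ ≠ 0) (hu1 : ρ - 1 + beta1 c' D ≠ 0) (hu2 : ρ - 1 + beta2 c' D ≠ 0)
    (hM : ContinuousAt (fun s : ℂ => calM2 c' χ d l (1 + s)) (ρ - 1)) :
    Tendsto (fun z => (z - (ρ - 1)) * integrand16_u023 c' χ d l z) (𝓝[≠] (ρ - 1))
      (𝓝 ((deriv χ.LFunction ρ)⁻¹ *
        (riemannZeta (ρ + beta1 c' D) * calM2 c' χ d l ρ * (riemannZeta ρ)⁻¹ *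
          ((d : ℂ) ^ (ρ - 1))⁻¹ *
          (((P4 D : ℝ) : ℂ) ^ (ρ - 1 + beta2 c' D) *
            GaussWeight.omega1 (ell D ^ 30) (ρ - 1 + beta2 c' D) / (ρ - 1 + beta2 c' D))))) := by
  set R : ℂ → ℂ := fun z => riemannZeta (1 + z + beta1 c' D) * calM2 c' χ d l (1 + z) *
    (riemannZeta (1 + z))⁻¹ * ((d : ℂ) ^ z)⁻¹ *
    (((P4 D : ℝ) : ℂ) ^ (z + beta2 c' D) * GaussWeight.omega1 (ell D ^ 30) (z + beta2 c' D) /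
      (z + beta2 c' D)) with hR
  have hRc : ContinuousAt R (ρ - 1) := by
    have cζ1 := ResidueValues.continuousAt_zeta_shift (beta1 c' D) (ρ - 1) hu1
    have h0 : ρ - 1 ≠ 0 := sub_ne_zero.mpr hρ1
    have cζ := ResidueValues.continuousAt_zeta_one_add (ρ - 1) h0
    have hζ' : riemannZeta (1 + (ρ - 1)) ≠ 0 := by rwa [show (1 : ℂ) + (ρ - 1) = ρ by ring]
    have cd := (continuousAt_cpow_inv (d := d) hd (ρ - 1)).1
    have cK := continuousAt_kernel (c' := c') hP hu2
    exact (((cζ1.mul hM).mul (cζ.inv₀ hζ')).mul cd).mul cK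
  have hprod := (tendsto_sub_mul_inv_LFunction hχ hLρ hL'ρ).mul
    (hRc.tendsto.mono_left nhdsWithin_le_nhds)
  have hval : R (ρ - 1) = riemannZeta (ρ + beta1 c' D) * calM2 c' χ d l ρ * (riemannZeta ρ)⁻¹ *
      ((d : ℂ) ^ (ρ - 1))⁻¹ *
      (((P4 D : ℝ) : ℂ) ^ (ρ - 1 + beta2 c' D) *
        GaussWeight.omega1 (ell D ^ 30) (ρ - 1 + beta2 c' D) / (ρ - 1 + beta2 c' D)) := by
    simp only [hR, show (1 : ℂ) + (ρ - 1) = ρ by ring]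
  rw [hval] at hprod
  refine hprod.congr fun z => ?_
  rw [hR]
  unfold integrand16_u023
  simp only [div_eq_mul_inv, mul_inv]
  ring

end OtherPoints

end Literature.NumberTheory.LFunctions.Zhang2022.Eq1610
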